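import Literature.NumberTheory.Automorphic.RankinSelbergTowerFiniteness
import Literature.NumberTheory.Automorphic.StandardTestFunGaussian
import HarnessLib

/-!
# The unfolded Rankin–Selberg integral is finite for the Gaussian standard test function

Topic `NumberTheory/Automorphic`; namespace `Literature.NumberTheory.Automorphic`. Proof file (theorems
only: no definition, no named fact, no instance). `RankinSelbergTowerFiniteness` proves the finiteness of the
unfolded Rankin–Selberg integral `Ψ(σ; W_φ, W̄_φ, Φ) = rankinSelbergTorusIntegral νA νK W_φ Φ σ`, `σ > 1`, of
the global Whittaker coefficient of every smoothed `L²` cusp form `φ = S_η f` against the standard test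
function `Φ = Φ_∞ ⊗ 𝟙_{𝒪̂ⁿ}` with the archimedean factor `Φ_∞ = e^{-‖z_∞‖}` (`jsArchTestFun`). The
complex-analytic half of the method (Poisson summation, the Eisenstein series and its poles:
`MirabolicEisensteinResidue`, `RankinSelbergIntegralResidue`, `RankinSelbergUnfoldingRealPoint`) needs a
test function in the Fourier-stable Schwartz–Bruhat class `piSchwartzBruhat`, e.g. the **Gaussian**
`Φ_∞ = e^{-‖T z_∞‖²}` of `StandardTestFunGaussian` (`gaussArchTestFun`; Cogdell (2004), §2.3 takes a
Gaussian at infinity). This file transfers the finiteness to it: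

* `gaussArchTestFun_le_mul_jsArchTestFun` — `e^{-‖T z‖²} ≤ e^{M²/4} e^{-‖z‖}` with `M = ‖T⁻¹‖`
  (`‖z‖ ≤ M ‖T z‖ ≤ ‖T z‖² + M²/4`);
* `standardTestFun_mono`, `torusIntegrand_mono_testFun`, `rankinSelbergTorusIntegral_mono_testFun`,
  `rankinSelbergTorusIntegral_const_mul_testFun` — monotonicity and scaling of the unfolded integral in
  the test function;
* `rankinSelbergTorusIntegral_whittakerCoeff_gauss_ne_top` (**main**) — `Ψ(σ; W_φ, W̄_φ, Φ_gauss) < ∞`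
  for every smoothed `L²` cusp form and every `σ > 1` (Jacquet–Shalika (1981), §4, (4.6): "converges
  absolutely for `Re s > 1`"; Cogdell (2004), §2.3).

## References

* H. Jacquet, J. A. Shalika, *On Euler products and the classification of automorphic
  representations I*, Amer. J. Math. 103 (1981), §4 [JacquetShalikaAJM1981].
* J. W. Cogdell, *Analytic theory of L-functions for GL_n*, in *An Introduction to the Langlands
  Program* (2004), §2.3 [CogdellAnalyticTheory2004].
-/

noncomputable section

open MeasureTheory Measure NumberField NumberField.mixedEmbedding IsDedekindDomain Matrix Set Filter Finset
open scoped MatrixGroups ENNReal NNReal Classical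
open Literature.NumberTheory.GaloisRepresentations (ideleGroup)

namespace Literature.NumberTheory.Automorphic

section Domination

variable (n : ℕ) (K : Type) [Field K] [NumberField K]

/-- **The Gaussian is dominated by a multiple of `e^{-‖z‖}`**: `e^{-‖T z‖²} ≤ e^{M²/4} · e^{-‖z‖}` with
`M = ‖T⁻¹‖` the operator norm of the inverse of the Euclidean isomorphism `T = toEuclidean`, because
`‖z‖ = ‖T⁻¹ (T z)‖ ≤ M ‖T z‖ ≤ ‖T z‖² + M²/4`. [folklore] -/
theorem gaussArchTestFun_le_mul_jsArchTestFun (z : Fin n → InfiniteAdeleRing K) :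
    gaussArchTestFun n K z ≤
      Real.exp (‖((toEuclidean (E := Fin n → mixedSpace K)).symm :
          EuclideanSpace ℝ (Fin (Module.finrank ℝ (Fin n → mixedSpace K))) →L[ℝ] (Fin n → mixedSpace K))‖ ^ 2 / 4) *
        jsArchTestFun n K z := by
  set T := toEuclidean (E := Fin n → mixedSpace K) with hT
  set M : ℝ := ‖((T.symm : EuclideanSpace ℝ (Fin (Module.finrank ℝ (Fin n → mixedSpace K))) →L[ℝ]
    (Fin n → mixedSpace K)))‖ with hM
  set x : Fin n → mixedSpace K := fun i => InfiniteAdeleRing.ringEquiv_mixedSpace K (z i) with hx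
  have hle : ‖x‖ ≤ M * ‖T x‖ := by
    have h := ((T.symm : EuclideanSpace ℝ (Fin (Module.finrank ℝ (Fin n → mixedSpace K))) →L[ℝ]
      (Fin n → mixedSpace K))).le_opNorm (T x)
    rwa [ContinuousLinearEquiv.coe_coe, ContinuousLinearEquiv.symm_apply_apply] at h
  have hkey : ‖x‖ ≤ ‖T x‖ ^ 2 + M ^ 2 / 4 := by
    nlinarith [sq_nonneg (‖T x‖ - M / 2), hle]
  unfold gaussArchTestFun jsArchTestFun
  rw [← Real.exp_add]
  exact Real.exp_le_exp.2 (by linarith)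

variable {n K}

/-- The standard test function is monotone in its archimedean factor. [folklore] -/
theorem standardTestFun_mono {Φ Φ' : (Fin n → InfiniteAdeleRing K) → ℝ} (h : ∀ z, Φ z ≤ Φ' z)
    (y : Fin n → AdeleRing (𝓞 K) K) : standardTestFun n K Φ y ≤ standardTestFun n K Φ' y := by
  classical
  unfold standardTestFun
  split_ifs
  · exact h _
  · exact le_rfl

/-- Scaling the archimedean factor scales the standard test function. [folklore] -/
theorem standardTestFun_const_mul (c : ℝ) (Φ : (Fin n → InfiniteAdeleRing K) → ℝ) (y : Fin n → AdeleRing (𝓞 K) K) :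
    standardTestFun n K (fun z => c * Φ z) y = c * standardTestFun n K Φ y := by
  classical
  unfold standardTestFun
  split_ifs
  · rfl
  · rw [mul_zero]

/-- The torus integrand is monotone in the test function (`Φ ≤ Φ'`). [folklore] -/
theorem torusIntegrand_mono_testFun {W : GL (Fin n) (AdeleRing (𝓞 K) K) → ℂ}
    {Φ Φ' : (Fin n → AdeleRing (𝓞 K) K) → ℝ} (h : ∀ y, Φ y ≤ Φ' y) (σ : ℝ)
    (p : (Fin n → ideleGroup K) × ↥(maximalCompactAdelic n K)) :
    torusIntegrand n K W Φ σ p ≤ torusIntegrand n K W Φ' σ p := by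
  unfold torusIntegrand
  exact ENNReal.ofReal_le_ofReal (mul_le_mul_of_nonneg_right
    (mul_le_mul_of_nonneg_left (h _) (sq_nonneg _)) (torusWeight_nonneg σ p.1))

/-- The torus integrand scales with a non-negative constant in the test function. [folklore] -/
theorem torusIntegrand_const_mul_testFun {W : GL (Fin n) (AdeleRing (𝓞 K) K) → ℂ} {c : ℝ} (hc : 0 ≤ c)
    (Φ : (Fin n → AdeleRing (𝓞 K) K) → ℝ) (σ : ℝ) (p : (Fin n → ideleGroup K) × ↥(maximalCompactAdelic n K)) :
    torusIntegrand n K W (fun y => c * Φ y) σ p = ENNReal.ofReal c * torusIntegrand n K W Φ σ p := by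
  unfold torusIntegrand
  rw [← ENNReal.ofReal_mul hc]
  congr 1
  ring

end Domination

/-! ### Finiteness for the Gaussian -/

section Gauss

variable {n : ℕ} {K : Type} [Field K] [NumberField K]
variable {μ : Measure (AdelicGroupData.gl n K).automorphicQuotient} [(AdelicGroupData.gl n K).IsAutomorphicMeasure μ]

-- Borel structures as in `RankinSelbergTowerFiniteness`.
attribute [local instance] adelicBorel borelSpace_adelic locallyCompactSpace_adelic
  secondCountableTopology_gl_adelic glAdeleBorel borelSpace_glAdele

variable [MeasurableSpace (ideleGroup K)]

/-- **The unfolded integral is monotone in the test function.** [folklore] -/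
theorem rankinSelbergTorusIntegral_mono_testFun (νA : Measure (Fin n → ideleGroup K))
    (νK : Measure ↥(maximalCompactAdelic n K)) {W : GL (Fin n) (AdeleRing (𝓞 K) K) → ℂ}
    {Φ Φ' : (Fin n → AdeleRing (𝓞 K) K) → ℝ} (h : ∀ y, Φ y ≤ Φ' y) (σ : ℝ) :
    rankinSelbergTorusIntegral n K νA νK W Φ σ ≤ rankinSelbergTorusIntegral n K νA νK W Φ' σ :=
  lintegral_mono fun p => torusIntegrand_mono_testFun h σ p

/-- **Scaling the test function by `c ≥ 0` scales the unfolded integral by `c`.** [folklore] -/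
theorem rankinSelbergTorusIntegral_const_mul_testFun (νA : Measure (Fin n → ideleGroup K))
    (νK : Measure ↥(maximalCompactAdelic n K)) {W : GL (Fin n) (AdeleRing (𝓞 K) K) → ℂ} {c : ℝ} (hc : 0 ≤ c)
    (Φ : (Fin n → AdeleRing (𝓞 K) K) → ℝ) (σ : ℝ) :
    rankinSelbergTorusIntegral n K νA νK W (fun y => c * Φ y) σ =
      ENNReal.ofReal c * rankinSelbergTorusIntegral n K νA νK W Φ σ := by
  unfold rankinSelbergTorusIntegral
  simp_rw [torusIntegrand_const_mul_testFun hc Φ σ]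
  rw [lintegral_const_mul' _ _ ENNReal.ofReal_ne_top]

omit [MeasurableSpace (ideleGroup K)] in
/-- **The unfolded Rankin–Selberg integral of a smoothed `L²` cusp form against the Gaussian standard test
function is finite for `σ > 1`**: `Ψ(σ; W_φ, W̄_φ, Φ_gauss) ≤ e^{M²/4} Ψ(σ; W_φ, W̄_φ, Φ_js) < ∞`
(`gaussArchTestFun_le_mul_jsArchTestFun`, monotonicity and scaling of the unfolded integral in the test
function, and `rankinSelbergTorusIntegral_whittakerCoeff_ne_top`). The Gaussian datum of Cogdell (2004),
§2.3 / the `…_gauss` statements of `RankinSelbergResidueDatum`. [cite: JacquetShalikaAJM1981, §4 (4.6)]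
[cite: CogdellAnalyticTheory2004, §2.3] -/
theorem rankinSelbergTorusIntegral_whittakerCoeff_gauss_ne_top (hn : 0 < n)
    [MeasurableSpace (ideleGroup K)] [BorelSpace (ideleGroup K)]
    (νA : Measure (Fin n → ideleGroup K)) [IsHaarMeasure νA]
    (νK : Measure ↥(maximalCompactAdelic n K)) [IsHaarMeasure νK]
    (ν₀ : Measure ↥(adelicUnipotent n K)) [IsHaarMeasure ν₀]
    {η : (AdelicGroupData.gl n K).Adelic → ℝ} (hη : IsTestFunctionGL n K η)
    {f : (AdelicGroupData.gl n K).L2 μ} (hf : f ∈ cuspidalSubspace n K μ) {σ : ℝ} (hσ : 1 < σ) :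
    rankinSelbergTorusIntegral n K νA νK
      (whittakerCoeff ν₀ (unipotentTateDomain n K) (adeleAddChar K)
        (invQuot (AdelicGroupData.gl n K) (smoothedForm η f)))
      (standardTestFun n K (gaussArchTestFun n K)) σ ≠ ⊤ := by
  set C : ℝ := Real.exp (‖((toEuclidean (E := Fin n → mixedSpace K)).symm :
    EuclideanSpace ℝ (Fin (Module.finrank ℝ (Fin n → mixedSpace K))) →L[ℝ] (Fin n → mixedSpace K))‖ ^ 2 / 4) with hC
  have hC0 : 0 ≤ C := (Real.exp_pos _).le
  have hdom : ∀ y, standardTestFun n K (gaussArchTestFun n K) y ≤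
      standardTestFun n K (fun z => C * jsArchTestFun n K z) y := fun y =>
    standardTestFun_mono (fun z => gaussArchTestFun_le_mul_jsArchTestFun n K z) y
  have hscale : ∀ y, standardTestFun n K (fun z => C * jsArchTestFun n K z) y =
      C * standardTestFun n K (jsArchTestFun n K) y := fun y => standardTestFun_const_mul C _ y
  have hle := rankinSelbergTorusIntegral_mono_testFun νA νK
    (W := whittakerCoeff ν₀ (unipotentTateDomain n K) (adeleAddChar K)
      (invQuot (AdelicGroupData.gl n K) (smoothedForm η f))) hdom σ
  have heq : (standardTestFun n K (fun z => C * jsArchTestFun n K z)) =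
      fun y => C * standardTestFun n K (jsArchTestFun n K) y := funext hscale
  rw [heq, rankinSelbergTorusIntegral_const_mul_testFun νA νK hC0] at hle
  exact ne_top_of_le_ne_top (ENNReal.mul_ne_top ENNReal.ofReal_ne_top
    (rankinSelbergTorusIntegral_whittakerCoeff_ne_top hn νA νK ν₀ hη hf hσ)) hle

end Gauss

end Literature.NumberTheory.Automorphic
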